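import Summits.BirchSwinnertonDyer.BirchSwinnertonDyer.Theorems.ByReductionTypeAtTwoFineSelmerConjAAtTwoAdditivePotGoodTwoLayerDoorEvenIndex
import Literature.NumberTheory.IwasawaTheory.Fukuda1994Thm1RankProofs
import Mathlib.NumberTheory.RamificationInertia.Basic
import HarnessLib

/-!
# Route `ByReductionTypeAtTwo` (rung K4), crux C1″ `FineSelmerConjAAtTwoAdditivePotGood` (item stmt-BirchSwinnertonDyer-22615):
# THE FUKUDA-ROWS DOOR — for the cubic point fields with EVEN class number: Fukuda's two-layer criterion (`e₁ = e₀`, or equal `2`-ranks)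
# with his standing hypothesis `n₀ = 0` DISCHARGED by the kernel (odd discriminant / one prime above `2` / even-index certificate)
# (a `--supports 22615` file; seat `bsd-2adic-k4-w1` GEN 5; sequel of `…TwoLayerDoor` and `…TwoLayerDoorEvenIndex`)

HONEST FRAMING (cell `bsd-2adic`, D-0036/D-0054/D-0152): types-the-object-of; closes nothing at the `∀`-level; nothing booked; BSD is not
proved by any of this. Inputs BY NAME: `hLim2` (per-curve doors). Fukuda 1994 Thm. 1 (1)/(2) are the tree's DISCHARGED facts (`…_holds`).

WHY. k4-w2 GEN 3's `bsdp_two_<L>_of_fukudaCertificate_pointField` rows (the census rows with `2 ∣ h(F)`, where Iwasawa 1956 and the two-layer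
door with `e₀ = 0` are void) display `hcert : ∀ κL cyclotomic, TotallyRamifiedFrom κL n₀ ∧ rank₂ Cl(F_{n+1}) = rank₂ Cl(F_n)` — TWO conjuncts, the
first STRUCTURAL (no finite datum decides it as typed). After p687770 / p689647 the first conjunct is KERNEL at `n₀ = 0` for every cubic field
whose primes above `2` all have odd index (odd discriminant: `𝔭₁𝔭₂`, `𝔭₁𝔭₂𝔭₃`, inert; or ONE prime above `2`: `𝔭³`, inert — §1) and for the
`𝔭²𝔮` fields with an even-index certificate. This file packages the resulting doors: (A)₂ from `hLim2` + ONE displayed numeric equality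
`e₁ = e₀` (order form, Fukuda (1)) or `rank₂ Cl(F₁) = rank₂ Cl(F)` (rank form, Fukuda (2)) — the census columns `v2h3 = v2h6` resp.
`rank2Cl3 = rank2Cl6` of `addL2x/gen5/conjA2_census_j289938_classes.tsv`.

* §1 `odd_ramificationIdx_of_existsUnique_two_mem` (cubic `F`, ONE prime above `2` ⟹ its index divides `3`, hence is odd: `Σ e f = 3`,
  Mathlib `Ideal.sum_ramification_inertia`), `forall_totallyRamifiedFrom_zero_of_existsUnique_two_mem`.
* §2 PER-CURVE DOORS `fineSelmerDual_moduleFinite_two_of_totallyRamified_of_succ_eq_pointField` (order form) and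
  `…_of_rank_succ_eq_pointField` (rank form): point field `ℚ(P) = ℚ(θ)`, `n₀ = 0` for every cyclotomic `κL` (any discharger), ONE equality.
* §3 DISCHARGERS in the cubic currency `ℚ(θ)`: `forall_totallyRamifiedFrom_zero_adjoin_of_odd_cubic_discr`,
  `…_adjoin_of_existsUnique_two_mem`, `…_adjoin_of_evenIndexCertificate`.

References: [Fukuda1994] Thm. 1 (1)(2), p. 264; [Washington1997] §13.1; [Lim2017FineSelmer] Thm. 3.5, Lemma 3.2; [CoatesSujatha2005] (A);
[NeukirchANT1999] Ch. I §8 (`Σ eᵢfᵢ = n`).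
-/

set_option autoImplicit false
-- sibling precedent (`…TwoLayerDoorEvenIndex.lean`): the directory name repeats the summit name
set_option linter.dupNamespace false

noncomputable section

open scoped Classical IntermediateField NumberField

namespace Summit.BirchSwinnertonDyer.BirchSwinnertonDyer.Theorems.AddKatoTwo

open WeierstrassCurve Field Polynomial IsDedekindDomain NumberField Literature.NumberTheory.EllipticCurves
  Literature.NumberTheory.GaloisRepresentations
  Literature.NumberTheory.IwasawaTheory
  Summit.BirchSwinnertonDyer.BirchSwinnertonDyer.Theorems.AlignedTransportAtTwoTorsionPointField
  Summit.BirchSwinnertonDyer.BirchSwinnertonDyer.Theses.ByReductionTypeAtTwo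

/-! ## §1 One prime above `2` in a cubic field ⟹ its index is odd ⟹ `n₀ = 0` -/

section UniquePrime

variable (F : Type) [Field F] [NumberField F]

/-- **In a cubic field with exactly ONE prime above `2`, that prime has odd ramification index** (`e·f = 3`, Mathlib's fundamental identity
`Ideal.sum_ramification_inertia` over the one-element set of primes above `2`, so `e ∣ 3`). [cite: NeukirchANT1999, Ch. I §8, Prop. (8.2) (`Σ eᵢ fᵢ = n`)] -/
theorem odd_ramificationIdx_of_existsUnique_two_mem (hF : Module.finrank ℚ F = 3)
    (hv : ∃! v : HeightOneSpectrum (𝓞 F), ((2 : ℕ) : 𝓞 F) ∈ v.asIdeal)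
    (w : HeightOneSpectrum (𝓞 F)) (hw : ((2 : ℕ) : 𝓞 F) ∈ w.asIdeal) : Odd (w.asIdeal.ramificationIdx ℤ) := by
  haveI : (Ideal.span {(2 : ℤ)}).IsMaximal :=
    Ideal.IsPrime.isMaximal ((Ideal.span_singleton_prime two_ne_zero).mpr Int.prime_two) (by simp)
  have h20 : (Ideal.span {(2 : ℤ)} : Ideal ℤ) ≠ ⊥ := by simp
  haveI : w.asIdeal.IsPrime := w.isPrime
  have hw2 : (2 : 𝓞 F) ∈ w.asIdeal := by exact_mod_cast hw
  haveI hwl : w.asIdeal.LiesOver (Ideal.span {(2 : ℤ)}) := by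
    rw [Ideal.liesOver_span_iff w.isPrime.ne_top Int.prime_two, map_ofNat]; exact hw2
  -- the set of primes above `2` is `{w}`
  have hS : IsDedekindDomain.primesOverFinset (Ideal.span {(2 : ℤ)}) (𝓞 F) = {w.asIdeal} := by
    refine Finset.eq_singleton_iff_unique_mem.mpr ⟨(IsDedekindDomain.mem_primesOverFinset_iff h20 _).mpr ⟨w.isPrime, hwl⟩, ?_⟩
    intro P hP
    obtain ⟨hPp, hPl⟩ := (IsDedekindDomain.mem_primesOverFinset_iff h20 _).mp hP
    have hP2 : (2 : 𝓞 F) ∈ P := by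
      have := (Ideal.liesOver_span_iff hPp.ne_top Int.prime_two).mp hPl; rwa [map_ofNat] at this
    have hP0 : P ≠ ⊥ := fun h => by rw [h, Ideal.mem_bot] at hP2; exact two_ne_zero hP2
    obtain ⟨v, hv2, huniq⟩ := hv
    have h1 := huniq ⟨P, hPp, hP0⟩ (by exact_mod_cast hP2)
    have h2 := huniq w hw
    have : (⟨P, hPp, hP0⟩ : HeightOneSpectrum (𝓞 F)) = w := h1.trans h2.symm
    exact congrArg HeightOneSpectrum.asIdeal this
  have hsum := Ideal.sum_ramification_inertia (R := ℤ) (𝓞 F) ℚ F (p := Ideal.span {(2 : ℤ)}) h20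
  rw [hS, Finset.sum_singleton, hF, Ideal.ramificationIdx'_eq_ramificationIdx _ _ h20] at hsum
  -- `e · f = 3` ⟹ `e ∣ 3` ⟹ `e` odd
  have hdvd : w.asIdeal.ramificationIdx ℤ ∣ 3 := ⟨_, hsum.symm⟩
  have hle : w.asIdeal.ramificationIdx ℤ ≤ 3 := Nat.le_of_dvd (by norm_num) hdvd
  interval_cases h : w.asIdeal.ramificationIdx ℤ
  · omega
  · exact odd_one
  · omega
  · decide

/-- **ONE prime above `2` in a cubic field ⟹ Fukuda's index is `0`** for every cyclotomic `ℤ₂`-extension (§1 + the parity criterion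
`totallyRamifiedFrom_zero_of_forall_odd_ramificationIdx`, p687770). [cite: Fukuda1994, p. 264] [cite: Washington1997, §13.1 Lemma 13.3] -/
theorem forall_totallyRamifiedFrom_zero_of_existsUnique_two_mem (hF : Module.finrank ℚ F = 3)
    (hv : ∃! v : HeightOneSpectrum (𝓞 F), ((2 : ℕ) : 𝓞 F) ∈ v.asIdeal) :
    ∀ κ : ZpExtension F 2, κ.IsCyclotomic → TotallyRamifiedFrom κ 0 := fun κ hκ =>
  totallyRamifiedFrom_zero_of_forall_odd_ramificationIdx (by rw [hF]; norm_num) κ hκ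
    (odd_ramificationIdx_of_existsUnique_two_mem F hF hv)

end UniquePrime

/-! ## §2 THE PER-CURVE DOORS: `n₀ = 0` (kernel, any discharger) + ONE displayed equality -/

section CurveDoor

variable {p q r : ℤ}

/-- **(A)₂ from Fukuda's two-layer criterion, ORDER form, per curve** (granted `hLim2`; Fukuda Thm. 1 (1) kernel): point field `ℚ(P) = ℚ(θ)`,
`n₀ = 0` for every cyclotomic `ℤ₂`-extension of `ℚ(θ)` (`hram`, to be discharged by §3), and ONE displayed equality `e₁ = e₀`
(`ord₂ h(ℚ(θ, √2)) = ord₂ h(ℚ(θ))`) ⟹ statement (A)₂(W). [cite: Lim2017FineSelmer, §3 Thm. 3.5 and Lemma 3.2]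
[cite: Fukuda1994, Thm. 1 (1), p. 264] [cite: CoatesSujatha2005, §3 statement (A)] -/
theorem fineSelmerDual_moduleFinite_two_of_totallyRamified_of_succ_eq_pointField
    (hLim2 : Lim2017.thm35_at_two_fineSelmerDual_moduleFinite_of_classicalMuVanishes_of_le_divisionField_four)
    (W : WeierstrassCurve ℚ) [W.IsElliptic] {P : geomTorsion W 2} (hP : P ≠ 0) {θ : AlgebraicClosure ℚ}
    (hFθ : IntermediateField.fixedField (MulAction.stabilizer (absoluteGaloisGroup ℚ) P) = IntermediateField.adjoin ℚ {θ})
    (hram : haveI : FiniteDimensional ℚ (IntermediateField.adjoin ℚ {θ}) :=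
        IntermediateField.adjoin.finiteDimensional ((AlgebraicClosure.isAlgebraic ℚ).isAlgebraic θ).isIntegral
      haveI : NumberField (IntermediateField.adjoin ℚ {θ}) := NumberField.mk
      ∀ κL : ZpExtension (IntermediateField.adjoin ℚ {θ}) 2, κL.IsCyclotomic → TotallyRamifiedFrom κL 0)
    (h01 : haveI : FiniteDimensional ℚ (IntermediateField.adjoin ℚ {θ}) :=
        IntermediateField.adjoin.finiteDimensional ((AlgebraicClosure.isAlgebraic ℚ).isAlgebraic θ).isIntegral
      haveI : NumberField (IntermediateField.adjoin ℚ {θ}) := NumberField.mk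
      ∀ κL : ZpExtension (IntermediateField.adjoin ℚ {θ}) 2, κL.IsCyclotomic → classNumberPExp κL 1 = classNumberPExp κL 0)
    (κ : ZpExtension ℚ 2) (hκ : κ.IsCyclotomic) :
    ∃ (γ : absoluteGaloisGroup ℚ) (D : W.FineSelmerDualData κ γ),
      Module.Finite ℤ_[2] (RestrictScalars ℤ_[2] (IwasawaAlgebra 2) D.X) := by
  haveI : FiniteDimensional ℚ (IntermediateField.adjoin ℚ {θ}) :=
    IntermediateField.adjoin.finiteDimensional ((AlgebraicClosure.isAlgebraic ℚ).isAlgebraic θ).isIntegral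
  haveI : NumberField (IntermediateField.adjoin ℚ {θ}) := NumberField.mk
  have hμP : ∀ κL : ZpExtension (IntermediateField.fixedField (MulAction.stabilizer (absoluteGaloisGroup ℚ) P)) 2,
      κL.IsCyclotomic → ClassicalMuVanishes κL := by
    rw [hFθ]
    exact fun κL hκL ↦ classicalMuVanishes_of_classNumberPExp_succ_eq fukuda1994_thm1_classNumberPExp_const_of_succ_eq_holds
      κL (hram κL hκL) le_rfl (h01 κL hκL)
  exact fineSelmerDual_moduleFinite_two_of_classicalMu_pointField hLim2 W hP hμP κ hκ

/-- **(A)₂ from Fukuda's two-layer criterion, RANK form, per curve** (granted `hLim2`; Fukuda Thm. 1 (2) kernel): as above with the displayed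
equality `rank₂ Cl(ℚ(θ, √2)) = rank₂ Cl(ℚ(θ))` (`classGroupPRank κL 1 = classGroupPRank κL 0`). [cite: Lim2017FineSelmer, §3 Thm. 3.5 and Lemma 3.2]
[cite: Fukuda1994, Thm. 1 (2), p. 264] [cite: CoatesSujatha2005, §3 statement (A)] -/
theorem fineSelmerDual_moduleFinite_two_of_totallyRamified_of_rank_succ_eq_pointField
    (hLim2 : Lim2017.thm35_at_two_fineSelmerDual_moduleFinite_of_classicalMuVanishes_of_le_divisionField_four)
    (W : WeierstrassCurve ℚ) [W.IsElliptic] {P : geomTorsion W 2} (hP : P ≠ 0) {θ : AlgebraicClosure ℚ}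
    (hFθ : IntermediateField.fixedField (MulAction.stabilizer (absoluteGaloisGroup ℚ) P) = IntermediateField.adjoin ℚ {θ})
    (hram : haveI : FiniteDimensional ℚ (IntermediateField.adjoin ℚ {θ}) :=
        IntermediateField.adjoin.finiteDimensional ((AlgebraicClosure.isAlgebraic ℚ).isAlgebraic θ).isIntegral
      haveI : NumberField (IntermediateField.adjoin ℚ {θ}) := NumberField.mk
      ∀ κL : ZpExtension (IntermediateField.adjoin ℚ {θ}) 2, κL.IsCyclotomic → TotallyRamifiedFrom κL 0)
    (h01 : haveI : FiniteDimensional ℚ (IntermediateField.adjoin ℚ {θ}) :=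
        IntermediateField.adjoin.finiteDimensional ((AlgebraicClosure.isAlgebraic ℚ).isAlgebraic θ).isIntegral
      haveI : NumberField (IntermediateField.adjoin ℚ {θ}) := NumberField.mk
      ∀ κL : ZpExtension (IntermediateField.adjoin ℚ {θ}) 2, κL.IsCyclotomic → classGroupPRank κL 1 = classGroupPRank κL 0)
    (κ : ZpExtension ℚ 2) (hκ : κ.IsCyclotomic) :
    ∃ (γ : absoluteGaloisGroup ℚ) (D : W.FineSelmerDualData κ γ),
      Module.Finite ℤ_[2] (RestrictScalars ℤ_[2] (IwasawaAlgebra 2) D.X) := by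
  haveI : FiniteDimensional ℚ (IntermediateField.adjoin ℚ {θ}) :=
    IntermediateField.adjoin.finiteDimensional ((AlgebraicClosure.isAlgebraic ℚ).isAlgebraic θ).isIntegral
  haveI : NumberField (IntermediateField.adjoin ℚ {θ}) := NumberField.mk
  have hμP : ∀ κL : ZpExtension (IntermediateField.fixedField (MulAction.stabilizer (absoluteGaloisGroup ℚ) P)) 2,
      κL.IsCyclotomic → ClassicalMuVanishes κL := by
    rw [hFθ]
    exact fun κL hκL ↦ classicalMuVanishes_of_classGroupPRank_succ_eq fukuda1994_thm1_classGroupPRank_const_of_succ_eq_holds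
      κL (hram κL hκL) le_rfl (h01 κL hκL)
  exact fineSelmerDual_moduleFinite_two_of_classicalMu_pointField hLim2 W hP hμP κ hκ

end CurveDoor

/-! ## §3 DISCHARGERS of `n₀ = 0` in the cubic currency `ℚ(θ)` -/

section Dischargers

variable {p q r : ℤ}

/-- `n₀ = 0` for every cyclotomic `ℤ₂`-extension of `ℚ(θ)`, `θ` a root of an irreducible integer cubic of ODD discriminant (`2 ∤ d_{ℚ(θ)}`).
KERNEL. [cite: Fukuda1994, p. 264] [cite: Washington1997, §13.1 Lemma 13.3] -/
theorem forall_totallyRamifiedFrom_zero_adjoin_of_odd_cubic_discr (hirr : Irreducible (Cubic.toPoly ⟨1, (p : ℚ), q, r⟩))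
    (hdisc : ¬ (2 : ℤ) ∣ Cubic.discr ⟨1, p, q, r⟩) {θ : AlgebraicClosure ℚ} (hθ : aeval θ (Cubic.toPoly ⟨1, (p : ℚ), q, r⟩) = 0) :
    haveI : FiniteDimensional ℚ (IntermediateField.adjoin ℚ {θ}) :=
      IntermediateField.adjoin.finiteDimensional ((AlgebraicClosure.isAlgebraic ℚ).isAlgebraic θ).isIntegral
    haveI : NumberField (IntermediateField.adjoin ℚ {θ}) := NumberField.mk
    ∀ κ : ZpExtension (IntermediateField.adjoin ℚ {θ}) 2, κ.IsCyclotomic → TotallyRamifiedFrom κ 0 := by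
  haveI : FiniteDimensional ℚ (IntermediateField.adjoin ℚ {θ}) :=
    IntermediateField.adjoin.finiteDimensional ((AlgebraicClosure.isAlgebraic ℚ).isAlgebraic θ).isIntegral
  haveI : NumberField (IntermediateField.adjoin ℚ {θ}) := NumberField.mk
  have h3 := finrank_adjoin_eq_three_of_irreducible hirr hθ
  exact forall_totallyRamifiedFrom_zero_of_not_dvd_discr (by rw [h3]; norm_num) (odd_discr_adjoin_of_odd_cubic_discr hirr hdisc hθ)

/-- `n₀ = 0` for every cyclotomic `ℤ₂`-extension of `ℚ(θ)`, `θ` a root of an irreducible integer cubic, when `ℚ(θ)` has exactly ONE prime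
above `2` (e.g. `…InertDoor`'s `existsUnique_two_mem_adjoin_of_odd`, `…EisensteinDoor`'s `existsUnique_two_mem_adjoin_of_eisenstein`). KERNEL.
[cite: Fukuda1994, p. 264] [cite: NeukirchANT1999, Ch. I §8, Prop. (8.2)] -/
theorem forall_totallyRamifiedFrom_zero_adjoin_of_existsUnique_two_mem (hirr : Irreducible (Cubic.toPoly ⟨1, (p : ℚ), q, r⟩))
    {θ : AlgebraicClosure ℚ} (hθ : aeval θ (Cubic.toPoly ⟨1, (p : ℚ), q, r⟩) = 0)
    (hv : ∃! v : HeightOneSpectrum (𝓞 (IntermediateField.adjoin ℚ {θ})), ((2 : ℕ) : 𝓞 (IntermediateField.adjoin ℚ {θ})) ∈ v.asIdeal) :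
    haveI : FiniteDimensional ℚ (IntermediateField.adjoin ℚ {θ}) :=
      IntermediateField.adjoin.finiteDimensional ((AlgebraicClosure.isAlgebraic ℚ).isAlgebraic θ).isIntegral
    haveI : NumberField (IntermediateField.adjoin ℚ {θ}) := NumberField.mk
    ∀ κ : ZpExtension (IntermediateField.adjoin ℚ {θ}) 2, κ.IsCyclotomic → TotallyRamifiedFrom κ 0 := by
  haveI : FiniteDimensional ℚ (IntermediateField.adjoin ℚ {θ}) :=
    IntermediateField.adjoin.finiteDimensional ((AlgebraicClosure.isAlgebraic ℚ).isAlgebraic θ).isIntegral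
  haveI : NumberField (IntermediateField.adjoin ℚ {θ}) := NumberField.mk
  exact forall_totallyRamifiedFrom_zero_of_existsUnique_two_mem _ (finrank_adjoin_eq_three_of_irreducible hirr hθ) hv

/-- `n₀ = 0` for every cyclotomic `ℤ₂`-extension of `ℚ(θ)` from an even-index certificate `u, v, m, m' ∈ 𝓞 ℚ(θ)` (type `2 = 𝔭²𝔮`). KERNEL.
[cite: Fukuda1994, p. 264] [cite: Washington1997, §13.1 Lemma 13.3] -/
theorem forall_totallyRamifiedFrom_zero_adjoin_of_evenIndexCertificate (hirr : Irreducible (Cubic.toPoly ⟨1, (p : ℚ), q, r⟩))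
    {θ : AlgebraicClosure ℚ} (hθ : aeval θ (Cubic.toPoly ⟨1, (p : ℚ), q, r⟩) = 0)
    (u v m m' : 𝓞 (IntermediateField.adjoin ℚ {θ})) (huv : u ^ 2 - 2 * v ^ 2 = 4 * m) (hm : m ^ 2 = 2 * m')
    (hN : ¬ (8 : ℤ) ∣ Algebra.norm ℤ (2 - m' ^ 3)) :
    haveI : FiniteDimensional ℚ (IntermediateField.adjoin ℚ {θ}) :=
      IntermediateField.adjoin.finiteDimensional ((AlgebraicClosure.isAlgebraic ℚ).isAlgebraic θ).isIntegral
    haveI : NumberField (IntermediateField.adjoin ℚ {θ}) := NumberField.mk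
    ∀ κ : ZpExtension (IntermediateField.adjoin ℚ {θ}) 2, κ.IsCyclotomic → TotallyRamifiedFrom κ 0 := by
  haveI : FiniteDimensional ℚ (IntermediateField.adjoin ℚ {θ}) :=
    IntermediateField.adjoin.finiteDimensional ((AlgebraicClosure.isAlgebraic ℚ).isAlgebraic θ).isIntegral
  haveI : NumberField (IntermediateField.adjoin ℚ {θ}) := NumberField.mk
  exact fun κ hκ => totallyRamifiedFrom_zero_of_evenIndexCertificate (finrank_adjoin_eq_three_of_irreducible hirr hθ) κ hκ
    u v m m' huv hm hN

end Dischargers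

end Summit.BirchSwinnertonDyer.BirchSwinnertonDyer.Theorems.AddKatoTwo

end
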